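import Summits.QuantumFields.YangMills.Theses.GronwallGap

/-!
# Crux `AnalyticDetour` (stmt-QuantumFields-8801), line `registered`:
# the stub `stub_torusPartitionDictionary` (the `withDensity … univ` spelling of the torus
# partition function is the Haar integral of the plaquette product, and it is positive)

Registered stub of the skeleton `Cruxes/AnalyticDetour/Lines/registered.lean` (route
`GronwallGap`, sub-problem `YangMills`), proved verbatim.  The crux speaks of the torus pressure
through the total mass of the heat-kernel-style weighted measure
`(∏_e dHaar).withDensity (ofReal ∘ groupHeatKernelWeight (fun _ => v) 0)` of
`Literature/MathematicalPhysics/QuantumLattice/HeatKernelGroup.lean`, for a single-plaquette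
weight `v : G → ℝ` on the discrete torus `(ℤ/(L+1)ℤ)^4`; the other stubs of the line use the
honest Bochner integral `Z(v, L) = ∫ ∏_q v(U_q) ∏_e dHaar(U_e)`.  This file is the dictionary
between the two spellings together with `0 < Z(v, L)`:

* `groupHeatKernelWeight (fun _ => v) 0 U = ∏_q v(U_q)` holds by `rfl`;
* `U ↦ ∏_q v(U_q)` is continuous on the compact configuration space `Edge → G` (a finite product
  of second-countable Borel factors, hence itself Borel), so it is integrable for the product of
  the Haar probability measures, and `withDensity_apply` + `ofReal_integral_eq_lintegral_ofReal`
  identify the total mass with `ofReal` of the Bochner integral;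
* the integrand is pointwise positive (`v > 0`), its support is everything, and product Haar is a
  probability measure, so the integral is positive (`integral_pos_iff_support_of_nonneg`).

This is the pattern of `Literature.MathematicalPhysics.QuantumLattice.FreeEnergy.
partitionFunction_eq_ofReal_integral` (Wilson weight) transcribed to a general continuous
positive plaquette weight.  No named facts are used; no definitions are introduced.
-/

namespace Summit.QuantumFields.YangMills.Theorems

open MeasureTheory
open Literature.MathematicalPhysics.QuantumFieldTheory (haarProbability GaugeConfig Plaquette Edge
  plaquetteHolonomy)
open Literature.MathematicalPhysics.QuantumLattice (groupHeatKernelWeight)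

/-- The plaquette product `U ↦ ∏_q v(U_q)` of a continuous single-plaquette weight is a
continuous function of the torus configuration (each holonomy is a word in the edge variables). -/
private theorem continuous_plaquetteProd {G : Type} [Group G] [TopologicalSpace G]
    [IsTopologicalGroup G] (L : ℕ) {v : G → ℝ} (hv : Continuous v) :
    Continuous fun U : GaugeConfig 4 (L + 1) G =>
      ∏ q : Plaquette 4 (L + 1), v (plaquetteHolonomy U q.1 q.2.1.1 q.2.1.2) := by
  refine continuous_finsetProd _ fun q _ => hv.comp ?_
  unfold plaquetteHolonomy
  fun_prop

/-- The plaquette product of a continuous weight is integrable for the product of the Haar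
probability measures over the edges of the torus (continuous on a compact space, finite measure). -/
private theorem integrable_plaquetteProd {G : Type} [Group G] [TopologicalSpace G]
    [IsTopologicalGroup G] [CompactSpace G] [SecondCountableTopology G] [MeasurableSpace G]
    [BorelSpace G] (L : ℕ) {v : G → ℝ} (hv : Continuous v) :
    Integrable (fun U : GaugeConfig 4 (L + 1) G =>
        ∏ q : Plaquette 4 (L + 1), v (plaquetteHolonomy U q.1 q.2.1.1 q.2.1.2))
      (Measure.pi fun _ : Edge 4 (L + 1) => haarProbability G) :=
  (continuous_plaquetteProd L hv).integrable_of_hasCompactSupport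
    (HasCompactSupport.of_compactSpace _)

/-- **Stub `stub_torusPartitionDictionary` — the `withDensity … univ` spelling of the crux's torus
partition function is the finite Haar integral of the plaquette product, and it is positive.**
For a compact second-countable Hausdorff group `G` with its Borel σ-algebra, every torus side
`L+1` and every continuous positive single-plaquette weight `v`,
`0 < Z(v,L) = ∫ ∏_q v(U_q) d(⊗_e Haar)` and the total mass of
`(⊗_e Haar).withDensity (ofReal ∘ groupHeatKernelWeight (fun _ => v) 0)` has `toReal = Z(v,L)`
(`groupHeatKernelWeight (fun _ => v) 0 U = ∏_q v(U_q)` by `rfl`; `lintegral` of `ofReal` of a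
non-negative integrable continuous function; positivity from full support under a probability
measure). -/
theorem stub_torusPartitionDictionary :
    ∀ (G : Type) [Group G] [TopologicalSpace G] [IsTopologicalGroup G] [CompactSpace G] [T2Space G] [SecondCountableTopology G] [MeasurableSpace G] [BorelSpace G], ∀ (L : ℕ) (v : G → ℝ), Continuous v → (∀ g : G, 0 < v g) → 0 < (∫ U : Literature.MathematicalPhysics.QuantumFieldTheory.GaugeConfig 4 (L + 1) G, ∏ q : Literature.MathematicalPhysics.QuantumFieldTheory.Plaquette 4 (L + 1), v (Literature.MathematicalPhysics.QuantumFieldTheory.plaquetteHolonomy U q.1 q.2.1.1 q.2.1.2) ∂(MeasureTheory.Measure.pi fun _ : Literature.MathematicalPhysics.QuantumFieldTheory.Edge 4 (L + 1) => Literature.MathematicalPhysics.QuantumFieldTheory.haarProbability G)) ∧ (((MeasureTheory.Measure.pi fun _ : Literature.MathematicalPhysics.QuantumFieldTheory.Edge 4 (L + 1) => Literature.MathematicalPhysics.QuantumFieldTheory.haarProbability G).withDensity (fun U : Literature.MathematicalPhysics.QuantumFieldTheory.GaugeConfig 4 (L + 1) G => ENNReal.ofReal (Literature.MathematicalPhysics.QuantumLattice.groupHeatKernelWeight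 (fun _ : ℝ => v) 0 U))) Set.univ).toReal = (∫ U : Literature.MathematicalPhysics.QuantumFieldTheory.GaugeConfig 4 (L + 1) G, ∏ q : Literature.MathematicalPhysics.QuantumFieldTheory.Plaquette 4 (L + 1), v (Literature.MathematicalPhysics.QuantumFieldTheory.plaquetteHolonomy U q.1 q.2.1.1 q.2.1.2) ∂(MeasureTheory.Measure.pi fun _ : Literature.MathematicalPhysics.QuantumFieldTheory.Edge 4 (L + 1) => Literature.MathematicalPhysics.QuantumFieldTheory.haarProbability G)) := by
  intro G _ _ _ _ _ _ _ _ L v hv hpos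
  haveI : IsProbabilityMeasure (Measure.pi fun _ : Edge 4 (L + 1) => haarProbability G) := by
    infer_instance
  -- the integrand, its integrability, non-negativity and positivity
  have hint := integrable_plaquetteProd L hv
  have hnn : ∀ U : GaugeConfig 4 (L + 1) G,
      0 ≤ ∏ q : Plaquette 4 (L + 1), v (plaquetteHolonomy U q.1 q.2.1.1 q.2.1.2) :=
    fun U => Finset.prod_nonneg fun q _ => (hpos _).le
  have hposU : ∀ U : GaugeConfig 4 (L + 1) G,
      0 < ∏ q : Plaquette 4 (L + 1), v (plaquetteHolonomy U q.1 q.2.1.1 q.2.1.2) :=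
    fun U => Finset.prod_pos fun q _ => hpos _
  refine ⟨?_, ?_⟩
  · -- positivity: full support under a probability measure
    rw [integral_pos_iff_support_of_nonneg hnn hint]
    have hsupp : Function.support (fun U : GaugeConfig 4 (L + 1) G =>
        ∏ q : Plaquette 4 (L + 1), v (plaquetteHolonomy U q.1 q.2.1.1 q.2.1.2)) = Set.univ :=
      Set.eq_univ_of_forall fun U => (hposU U).ne'
    rw [hsupp, measure_univ]
    exact one_pos
  · -- the dictionary: `withDensity … univ = ∫⁻ ofReal (∏ …) = ofReal (∫ ∏ …)`
    rw [withDensity_apply _ MeasurableSet.univ, Measure.restrict_univ]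
    change (∫⁻ U, ENNReal.ofReal (∏ q : Plaquette 4 (L + 1),
        v (plaquetteHolonomy U q.1 q.2.1.1 q.2.1.2))
      ∂(Measure.pi fun _ : Edge 4 (L + 1) => haarProbability G)).toReal = _
    rw [← ofReal_integral_eq_lintegral_ofReal hint (ae_of_all _ hnn),
      ENNReal.toReal_ofReal (integral_nonneg hnn)]

end Summit.QuantumFields.YangMills.Theorems
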